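import Literature.NumberTheory.Automorphic.QuaternionAdelicUnitsPlaceSplitting
import Literature.NumberTheory.Automorphic.GLnPlacesSplitting
import HarnessLib

/-!
# `D_𝔸ˣ = D_Sˣ × D^{S,×}`: splitting off a finite set of finite places of the adelic unit group of an
# algebra, as a topological group
(Gelbart, *Automorphic forms on adele groups* (1975), §10, p. 153: "`G_𝔸 = G_S × G^S`" for `G' = Dˣ`)

Topic `NumberTheory/Automorphic`; definitions with bodies (`Quat.LocalPi`, `Quat.toAdelicPi`,
`Quat.trivialAt`, `Quat.awayFromPlaces`, `Quat.placesSplitting`) and theorems; no named fact, no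
instance. The `Dˣ` twin of the tree's `GLnPlacesSplitting` (`GLn.placesSplitting : G_S × G^S ≃ₜ* GL_n(𝔸_K)`),
generalising the one-place `Quat.placeSplitting` (`QuaternionAdelicUnitsPlaceSplitting`) to a finite set
`S` of finite places — the form in which it enters the comparison of trace formulas (`S ⊇ Ram(D)`):

* `Quat.LocalPi K D S = D_Sˣ = Π_{v ∈ S} D_vˣ`; `Quat.toAdelicPi : D_Sˣ →* D_𝔸ˣ`, `t ↦ Π_{v ∈ S} ι_v(t_v)`
  (the local embeddings at distinct places commute, `Quat.ofLocal_comm_of_ne`; Mathlib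
  `MonoidHom.noncommPiCoprod`), continuous, with `(ι_S t)_v = t_v` (`v ∈ S`), `= 1` (`v ∉ S`);
* `Quat.trivialAt K D S = D^{S,×} = {x : x_v = 1, v ∈ S}` (closed), commuting with `ι_S(D_Sˣ)`;
* `Quat.awayFromPlaces K D S x = ι_S(x_S)⁻¹ x ∈ D^{S,×}`;
* `Quat.placesSplitting K D S : D_Sˣ × D^{S,×} ≃ₜ* D_𝔸ˣ`, `(t, c) ↦ ι_S(t) c`.

Part of the inline (D-0026) decomposition of
`Literature.NumberTheory.Automorphic.strong_multiplicity_one_quaternionUnits`.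

## References

* S. Gelbart, *Automorphic forms on adele groups*, Ann. of Math. Studies 83 (1975), §10, p. 153
  [Gelbart1975].
* H. Jacquet, R. P. Langlands, *Automorphic forms on GL(2)*, LNM 114 (1970), §14 [JacquetLanglands1970].
-/

noncomputable section

open NumberField IsDedekindDomain Topology

universe u

namespace Literature.NumberTheory.Automorphic

section Splitting

variable (K : Type) [Field K] [NumberField K] (D : Type u) [Ring D] [Algebra K D]
  (S : Finset (HeightOneSpectrum (𝓞 K)))

variable {K D S} in
/-- **The local embeddings at distinct places commute** (`ι_w(D_wˣ)` is trivial at `v`,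
`Quat.toCompletionUnits_ofLocal_of_ne`, and commutes with `ι_v(D_vˣ)`,
`Quat.ofLocal_mul_eq_mul_ofLocal_of_toCompletionUnits_eq_one`). [folklore] -/
theorem Quat.ofLocal_comm_of_ne {v w : HeightOneSpectrum (𝓞 K)} (hvw : v ≠ w) (t : completionUnits D v)
    (t' : completionUnits D w) :
    Quat.ofLocal K D v t * Quat.ofLocal K D w t' = Quat.ofLocal K D w t' * Quat.ofLocal K D v t :=
  Quat.ofLocal_mul_eq_mul_ofLocal_of_toCompletionUnits_eq_one t (Quat.toCompletionUnits_ofLocal_of_ne K D w hvw t')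

/-- **`D_Sˣ = Π_{v ∈ S} D_vˣ`**, as a `Π`-type over `↥S`. [cite: Gelbart1975, §10 p. 153] -/
abbrev Quat.LocalPi : Type u := ∀ v : S, completionUnits D (v : HeightOneSpectrum (𝓞 K))

/-- **`ι_S : D_Sˣ →* D_𝔸ˣ`, `t ↦ Π_{v ∈ S} ι_v(t_v)`.** [cite: Gelbart1975, §10 p. 153] -/
def Quat.toAdelicPi : Quat.LocalPi K D S →* adelicUnits K D :=
  MonoidHom.noncommPiCoprod (fun v : S => Quat.ofLocal K D (v : HeightOneSpectrum (𝓞 K)))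
    fun _ _ hvw a b => Quat.ofLocal_comm_of_ne (fun h => hvw (Subtype.ext h)) a b

/-- **`D^{S,×} = {x ∈ D_𝔸ˣ : x_v = 1 for all v ∈ S}`.** [cite: Gelbart1975, §10 p. 153] -/
def Quat.trivialAt : Subgroup (adelicUnits K D) := ⨅ v ∈ S, (toCompletionUnits K D v).ker

/-- **The part of `x` away from `S`**: `s_S(x) = ι_S(x_S)⁻¹ x`. [cite: Gelbart1975, §10 p. 153] -/
def Quat.awayFromPlaces (x : adelicUnits K D) : adelicUnits K D :=
  (Quat.toAdelicPi K D S fun v => toCompletionUnits K D (v : HeightOneSpectrum (𝓞 K)) x)⁻¹ * x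

variable {K D S}

/-- `ι_S(t) = Π_{v ∈ S} ι_v(t_v)` (`Finset.noncommProd`). [folklore] -/
theorem Quat.toAdelicPi_apply (t : Quat.LocalPi K D S) :
    Quat.toAdelicPi K D S t = (Finset.univ : Finset S).noncommProd
      (fun v => Quat.ofLocal K D (v : HeightOneSpectrum (𝓞 K)) (t v))
      (fun v _ w _ hvw => Quat.ofLocal_comm_of_ne (fun h => hvw (Subtype.ext h)) (t v) (t w)) :=
  MonoidHom.noncommPiCoprod_apply _ t

/-- Membership in `D^{S,×}`. [folklore] -/
theorem Quat.mem_trivialAt_iff {x : adelicUnits K D} :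
    x ∈ Quat.trivialAt K D S ↔ ∀ v ∈ S, toCompletionUnits K D v x = 1 := by
  simp only [Quat.trivialAt, Subgroup.mem_iInf, MonoidHom.mem_ker]

/-- **`(ι_S t)_v = t_v` for `v ∈ S`.** [folklore] -/
theorem Quat.toCompletionUnits_toAdelicPi_of_mem {v : HeightOneSpectrum (𝓞 K)} (hv : v ∈ S) (t : Quat.LocalPi K D S) :
    toCompletionUnits K D v (Quat.toAdelicPi K D S t) = t ⟨v, hv⟩ := by
  classical
  rw [Quat.toAdelicPi_apply, Finset.map_noncommProd]
  rw [← Finset.mul_noncommProd_erase (Finset.univ : Finset S) (Finset.mem_univ ⟨v, hv⟩)]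
  rw [Finset.noncommProd_eq_pow_card _ _ _ 1, one_pow, mul_one, Quat.toCompletionUnits_ofLocal]
  intro w hw
  have hw' : (w : HeightOneSpectrum (𝓞 K)) ≠ v := fun h => (Finset.mem_erase.1 hw).1 (Subtype.ext h)
  exact Quat.toCompletionUnits_ofLocal_of_ne K D _ hw'.symm (t w)

/-- **`(ι_S t)_v = 1` for `v ∉ S`.** [folklore] -/
theorem Quat.toCompletionUnits_toAdelicPi_of_not_mem {v : HeightOneSpectrum (𝓞 K)} (hv : v ∉ S) (t : Quat.LocalPi K D S) :
    toCompletionUnits K D v (Quat.toAdelicPi K D S t) = 1 := by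
  classical
  rw [Quat.toAdelicPi_apply, Finset.map_noncommProd, Finset.noncommProd_eq_pow_card _ _ _ 1, one_pow]
  intro w _
  have hw' : (w : HeightOneSpectrum (𝓞 K)) ≠ v := fun h => hv (h ▸ w.2)
  exact Quat.toCompletionUnits_ofLocal_of_ne K D _ hw'.symm (t w)

/-- **`ι_S(D_Sˣ)` commutes with `D^{S,×}`.** [folklore] -/
theorem Quat.toAdelicPi_mul_eq_mul_of_mem_trivialAt {c : adelicUnits K D} (hc : c ∈ Quat.trivialAt K D S)
    (t : Quat.LocalPi K D S) : Quat.toAdelicPi K D S t * c = c * Quat.toAdelicPi K D S t := by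
  have hcomm : Commute c (Quat.toAdelicPi K D S t) := by
    refine MonoidHom.commute_noncommPiCoprod _ (fun v x => ?_) t
    exact (Quat.ofLocal_mul_eq_mul_ofLocal_of_toCompletionUnits_eq_one x ((Quat.mem_trivialAt_iff.1 hc) v v.2)).symm
  exact hcomm.eq.symm

/-- The part of `x` away from `S` is trivial at the places of `S`. [folklore] -/
theorem Quat.awayFromPlaces_mem_trivialAt (x : adelicUnits K D) : Quat.awayFromPlaces K D S x ∈ Quat.trivialAt K D S := by
  rw [Quat.mem_trivialAt_iff]
  intro v hv
  rw [Quat.awayFromPlaces, map_mul, map_inv, Quat.toCompletionUnits_toAdelicPi_of_mem hv, inv_mul_cancel]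

/-- **`x = ι_S(x_S) · s_S(x)`.** [folklore] -/
theorem Quat.toAdelicPi_mul_awayFromPlaces (x : adelicUnits K D) :
    Quat.toAdelicPi K D S (fun v => toCompletionUnits K D (v : HeightOneSpectrum (𝓞 K)) x) * Quat.awayFromPlaces K D S x = x := by
  rw [Quat.awayFromPlaces, mul_inv_cancel_left]

/-- `s_S(ι_S(t) c) = c` for `c ∈ D^{S,×}`. [folklore] -/
theorem Quat.awayFromPlaces_toAdelicPi_mul (t : Quat.LocalPi K D S) {c : adelicUnits K D} (hc : c ∈ Quat.trivialAt K D S) :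
    Quat.awayFromPlaces K D S (Quat.toAdelicPi K D S t * c) = c := by
  have hcomp : (fun v : S => toCompletionUnits K D (v : HeightOneSpectrum (𝓞 K)) (Quat.toAdelicPi K D S t * c)) = t := by
    funext v
    rw [map_mul, Quat.toCompletionUnits_toAdelicPi_of_mem v.2, (Quat.mem_trivialAt_iff.1 hc) v v.2, mul_one]
  rw [Quat.awayFromPlaces, hcomp, inv_mul_cancel_left]

/-- An element of `D^{S,×}` is its own part away from `S`. [folklore] -/
theorem Quat.awayFromPlaces_eq_self_of_mem {c : adelicUnits K D} (hc : c ∈ Quat.trivialAt K D S) :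
    Quat.awayFromPlaces K D S c = c := by
  have h1 : (fun v : S => toCompletionUnits K D (v : HeightOneSpectrum (𝓞 K)) c) = 1 :=
    funext fun v => (Quat.mem_trivialAt_iff.1 hc) _ v.2
  rw [Quat.awayFromPlaces, h1, map_one, inv_one, one_mul]

variable (K D S)

/-- `ι_S` is continuous. [folklore] -/
theorem Quat.continuous_toAdelicPi [Module.Finite K D] : Continuous (Quat.toAdelicPi K D S) := by
  refine (continuous_finset_noncommProd (Finset.univ : Finset S)
    (fun (v : S) (t : Quat.LocalPi K D S) => Quat.ofLocal K D (v : HeightOneSpectrum (𝓞 K)) (t v))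
    (fun t v _ w _ hvw => Quat.ofLocal_comm_of_ne (fun h => hvw (Subtype.ext h)) (t v) (t w))
    (fun v _ => (Quat.continuous_ofLocal K D v).comp (continuous_apply v))).congr fun t => ?_
  exact (Quat.toAdelicPi_apply t).symm

/-- `s_S` is continuous. [folklore] -/
theorem Quat.continuous_awayFromPlaces [Module.Finite K D] : Continuous (Quat.awayFromPlaces K D S) :=
  ((Quat.continuous_toAdelicPi K D S).comp
    (continuous_pi fun v : S => continuous_toCompletionUnits K D (v : HeightOneSpectrum (𝓞 K)))).inv.mul continuous_id

/-- `D^{S,×}` is closed. [folklore] -/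
theorem Quat.isClosed_trivialAt [Module.Finite K D] :
    IsClosed ((Quat.trivialAt K D S : Subgroup (adelicUnits K D)) : Set (adelicUnits K D)) := by
  have h : ((Quat.trivialAt K D S : Subgroup (adelicUnits K D)) : Set (adelicUnits K D)) =
      ⋂ v ∈ S, toCompletionUnits K D v ⁻¹' {1} := by
    ext x
    simp only [SetLike.mem_coe, Quat.mem_trivialAt_iff, Set.mem_iInter, Set.mem_preimage, Set.mem_singleton_iff]
  rw [h]
  exact isClosed_biInter fun v _ => isClosed_singleton.preimage (continuous_toCompletionUnits K D v)

/-- **`D_Sˣ × D^{S,×} ≃ₜ* D_𝔸ˣ`, `(t, c) ↦ ι_S(t) c`** — the internal direct product decomposition of the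
adelic unit group into its components at the places of `S` and the closed subgroup of units trivial
there. Gelbart (1975), p. 153: `G_𝔸 = G_S × G^S`. [cite: Gelbart1975, §10 p. 153] -/
def Quat.placesSplitting [Module.Finite K D] : Quat.LocalPi K D S × Quat.trivialAt K D S ≃ₜ* adelicUnits K D where
  toFun p := Quat.toAdelicPi K D S p.1 * (p.2 : adelicUnits K D)
  invFun x := (fun v => toCompletionUnits K D (v : HeightOneSpectrum (𝓞 K)) x,
    ⟨Quat.awayFromPlaces K D S x, Quat.awayFromPlaces_mem_trivialAt x⟩)
  left_inv p := by
    rcases p with ⟨t, c⟩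
    refine Prod.ext (funext fun v => ?_) (Subtype.ext ?_)
    · change toCompletionUnits K D (v : HeightOneSpectrum (𝓞 K)) (Quat.toAdelicPi K D S t * (c : adelicUnits K D)) = t v
      rw [map_mul, Quat.toCompletionUnits_toAdelicPi_of_mem v.2, (Quat.mem_trivialAt_iff.1 c.2) _ v.2, mul_one]
    · exact Quat.awayFromPlaces_toAdelicPi_mul t c.2
  right_inv x := Quat.toAdelicPi_mul_awayFromPlaces x
  map_mul' p q := by
    rcases p with ⟨t, c⟩
    rcases q with ⟨t', c'⟩
    change Quat.toAdelicPi K D S (t * t') * ((c * c' : Quat.trivialAt K D S) : adelicUnits K D) =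
      Quat.toAdelicPi K D S t * (c : adelicUnits K D) * (Quat.toAdelicPi K D S t' * (c' : adelicUnits K D))
    rw [map_mul, Subgroup.coe_mul, mul_assoc, mul_assoc, ← mul_assoc (c : adelicUnits K D),
      ← Quat.toAdelicPi_mul_eq_mul_of_mem_trivialAt c.2 t', mul_assoc]
  continuous_toFun := ((Quat.continuous_toAdelicPi K D S).comp continuous_fst).mul
    (continuous_subtype_val.comp continuous_snd)
  continuous_invFun :=
    (continuous_pi fun v : S => continuous_toCompletionUnits K D (v : HeightOneSpectrum (𝓞 K))).prodMk
      ((Quat.continuous_awayFromPlaces K D S).subtype_mk _)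

variable {K D S}

/-- `placesSplitting (t, c) = ι_S(t) c` (definitional). [folklore] -/
@[simp]
theorem Quat.placesSplitting_apply [Module.Finite K D] (p : Quat.LocalPi K D S × Quat.trivialAt K D S) :
    Quat.placesSplitting K D S p = Quat.toAdelicPi K D S p.1 * (p.2 : adelicUnits K D) := rfl

/-- First component of the inverse: the `S`-components. [folklore] -/
@[simp]
theorem Quat.placesSplitting_symm_apply_fst [Module.Finite K D] (x : adelicUnits K D) (v : S) :
    ((Quat.placesSplitting K D S).symm x).1 v = toCompletionUnits K D (v : HeightOneSpectrum (𝓞 K)) x := rfl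

/-- Second component of the inverse: the part away from `S`. [folklore] -/
@[simp]
theorem Quat.placesSplitting_symm_apply_snd [Module.Finite K D] (x : adelicUnits K D) :
    (((Quat.placesSplitting K D S).symm x).2 : adelicUnits K D) = Quat.awayFromPlaces K D S x := rfl

/-- `placesSplitting (t, 1) = ι_S(t)`. [folklore] -/
theorem Quat.placesSplitting_inl [Module.Finite K D] (t : Quat.LocalPi K D S) :
    Quat.placesSplitting K D S (t, 1) = Quat.toAdelicPi K D S t := by
  rw [Quat.placesSplitting_apply, OneMemClass.coe_one, mul_one]

/-- `placesSplitting (1, c) = c`. [folklore] -/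
theorem Quat.placesSplitting_inr [Module.Finite K D] (c : Quat.trivialAt K D S) :
    Quat.placesSplitting K D S (1, c) = c := by
  rw [Quat.placesSplitting_apply, map_one, one_mul]

end Splitting

end Literature.NumberTheory.Automorphic
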